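import Mathlib
import Summits.Ventures.HodgeRepro.CMType
import Summits.Ventures.HodgeRepro.HodgeSets
import Summits.Ventures.HodgeRepro.CMRank
import Summits.Ventures.HodgeRepro.Groups
import Summits.Ventures.HodgeRepro.Primitive
import Summits.Ventures.HodgeRepro.MuTable
import Summits.Ventures.HodgeRepro.MuDecide
import Summits.Ventures.HodgeRepro.MuWeightsTransport
import Summits.Ventures.HodgeRepro.MuPairs
import Summits.Ventures.HodgeRepro.MuPairsRank
import Summits.Ventures.HodgeRepro.MuPairsCensusGen
import Summits.Ventures.HodgeRepro.RankCertZ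
import Summits.Ventures.HodgeRepro.RankCensus12c
import Summits.Ventures.HodgeRepro.RankCensus12d

/-! # The pairs theorem across the census: degree 12: `C6 × C2` (three central involutions), every CM type of rank `≠ 6` (seat p2; see `MuPairsCensusGen.lean`). -/

set_option autoImplicit false

open Finset
open scoped Pointwise

namespace HodgeRepro

/-- `C6 × C2`, first involution: every CM type of rank `≠ 6` (the rank-`6` orbits are the primitive
degenerate sextic types, outside the pairs regime). -/
theorem isPairUnion_C6xC2 {Φ : Finset C6xC2} (hΦ : IsCMType cc_C6xC2 Φ) (hne : cmRank Φ ≠ 6)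
    {Δ : Finset C6xC2} (hΔ : IsHodgeSet cc_C6xC2 Φ Δ) : IsPairUnion Φ Δ :=
  isPairUnion_of_cover_ne cc_C6xC2_isComplexConj reps_C6xC2 ranks_C6xC2 6 (by decide)
    cmRank_reps_C6xC2 (by decide) (by decide) (fun _ h => isCMType_C6xC2_cover h) hΦ hne hΔ

/-- `C6 × C2`, second involution: every Hodge set of every CM type of rank `≠ 6` is a union of antipodal pairs. -/
theorem isPairUnion_C6xC2' {Φ : Finset C6xC2} (hΦ : IsCMType cc_C6xC2' Φ) (hne : cmRank Φ ≠ 6)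
    {Δ : Finset C6xC2} (hΔ : IsHodgeSet cc_C6xC2' Φ Δ) : IsPairUnion Φ Δ :=
  isPairUnion_of_cover_ne (c := cc_C6xC2') (by decide) reps_C6xC2p ranks_C6xC2p 6 (by decide)
    cmRank_reps_C6xC2p (by decide) (by decide) (fun _ h => isCMType_C6xC2p_cover h) hΦ hne hΔ

/-- `C6 × C2`, third involution: every Hodge set of every CM type of rank `≠ 6` is a union of antipodal pairs. -/
theorem isPairUnion_C6xC2'' {Φ : Finset C6xC2} (hΦ : IsCMType cc_C6xC2'' Φ) (hne : cmRank Φ ≠ 6)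
    {Δ : Finset C6xC2} (hΔ : IsHodgeSet cc_C6xC2'' Φ Δ) : IsPairUnion Φ Δ :=
  isPairUnion_of_cover_ne (c := cc_C6xC2'') (by decide) reps_C6xC2pp ranks_C6xC2pp 6 (by decide)
    cmRank_reps_C6xC2pp (by decide) (by decide) (fun _ h => isCMType_C6xC2pp_cover h) hΦ hne hΔ

end HodgeRepro
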